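import Summits.RiemannHypothesis.RiemannHypothesis.Theorems.HandoffDodgerFarTailGridLower
import HarnessLib

/-!
# HANDOFF — the FAR ZERO-TAIL of the dodger, evaluation layer III: the upper half of the grid and the grid total (rh-explicit, track «HANDOFF», seat prove-2 gen14, ATTEMPT-24 §1, brick FT part 4)

HONEST FRAMING. Nothing here bears on the truth of RH; this is zero COUNTING (RH-free upper-side bookkeeping of the dodger's far-zone cost). The density
integral on `[3X/2, T]`, `T ≥ 8X` (six pieces `X·{3/2,2,5/2,3,4,6,8}` + the tail beyond `8X`): `integral_farDensity_upper_le`; the final numeric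
step over abstract reals `farDensity_numeric_final` (`π ∈ (3.141592, 3.141593)`); and **`integral_farDensity_le`**: for `X ≥ e⁸`, `T ≥ 8X`,
`∫_{X/4}^{T} (log(t/2π)/(2π)) e^{−X²/t²}/t² dt ≤ (0.16135·log X − 0.1143)/X` (the sharp leading constant would be `(1/2π)∫₀^4 e^{−u²}du ≈ 0.1412`).
No `sorry`, standard axioms, no definitions.

References: this track (HOME/handoff/prove-2/ATTEMPT-16.md §4 Lemma C3; ATTEMPT-24.md §1). Hasanalizade–Shen–Wong 2022 Cor. 1.2 (tree).
-/

set_option linter.dupNamespace false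

noncomputable section

open Real Finset MeasureTheory intervalIntegral Set

namespace Summit.RiemannHypothesis.RiemannHypothesis.Theorems.Handoff

open Literature.NumberTheory.LFunctions Literature.NumberTheory.LFunctions.SchoenfeldBound
  Literature.NumberTheory.LFunctions.KadiriTail

/-- The density integral on the upper half of the grid and the tail, `[3X/2, T]`, `T ≥ 8X` (six pieces + tail). [this track, ATTEMPT-24 §1] -/
theorem integral_farDensity_upper_le {X T : ℝ} (hX : Real.exp 8 ≤ X) (hT : X * 8 ≤ T) :
    ∫ t in X * (3 / 2)..T, Real.log (t / (2 * π)) / (2 * π) * (Real.exp (-X ^ 2 / t ^ 2) / t ^ 2) ≤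
      (72003143 / 120000000 : ℝ) * (Real.log X / (2 * π * X)) + (-17074922579 / 400000000000 : ℝ) * (1 / (2 * π * X)) := by
  have hπ := Real.pi_pos
  have he8 : (2980 : ℝ) ≤ Real.exp 8 := by
    have h : Real.exp 8 = Real.exp 1 ^ 8 := by rw [← Real.exp_nat_mul]; norm_num
    rw [h]
    have := Real.exp_one_gt_d9
    nlinarith [pow_le_pow_left₀ (by norm_num : (0:ℝ) ≤ 2.7182818283) this.le 8]
  have hX0 : 0 < X := by linarith
  have h2π0 : (0:ℝ) < 2 * π := by positivity
  have h2π4 : 2 * π ≤ X * (1 / 4) := by linarith [Real.pi_lt_d6]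
  have hL2π := log_two_pi_ge
  -- from `2π ≤ X/4` to `2π ≤ X p`
  have h2πp : ∀ p : ℝ, 1 / 4 ≤ p → 2 * π ≤ X * p := fun p hp =>
    h2π4.trans (mul_le_mul_of_nonneg_left hp hX0.le)
  have h4p : ∀ p : ℝ, 1 / 4 ≤ p → X * (1 / 4) ≤ X * p := fun p hp => mul_le_mul_of_nonneg_left hp hX0.le
  -- integrability of the density weight on `[X/4, ∞)`
  have hI : ∀ a b : ℝ, X * (1 / 4) ≤ a → X * (1 / 4) ≤ b →
      IntervalIntegrable (fun t : ℝ => Real.log (t / (2 * π)) / (2 * π) * (Real.exp (-X ^ 2 / t ^ 2) / t ^ 2)) volume a b := by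
    intro a b ha hb
    refine ContinuousOn.intervalIntegrable (continuousOn_of_forall_continuousAt fun t ht => ?_)
    have hmin : X * (1 / 4) ≤ min a b := le_min ha hb
    have h1 : min a b ≤ t := ht.1
    have ht0 : 0 < t := by nlinarith
    have : t ≠ 0 := ht0.ne'
    have : t / (2 * π) ≠ 0 := by positivity
    fun_prop (disch := (first | assumption | positivity))
  have hTop : X * (1 / 4) ≤ T := le_trans (h4p 8 (by norm_num)) hT
  have e7 : (∫ t in X * (3/2)..T, Real.log (t / (2 * π)) / (2 * π) * (Real.exp (-X ^ 2 / t ^ 2) / t ^ 2)) = (∫ t in X * (3/2)..X * (2), Real.log (t / (2 * π)) / (2 * π) * (Real.exp (-X ^ 2 / t ^ 2) / t ^ 2)) + ∫ t in X * (2)..T, Real.log (t / (2 * π)) / (2 * π) * (Real.exp (-X ^ 2 / t ^ 2) / t ^ 2) :=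
    (intervalIntegral.integral_add_adjacent_intervals (hI _ _ (h4p _ (by norm_num)) (h4p _ (by norm_num)))
      (hI _ _ (h4p _ (by norm_num)) hTop)).symm
  have e8 : (∫ t in X * (2)..T, Real.log (t / (2 * π)) / (2 * π) * (Real.exp (-X ^ 2 / t ^ 2) / t ^ 2)) = (∫ t in X * (2)..X * (5/2), Real.log (t / (2 * π)) / (2 * π) * (Real.exp (-X ^ 2 / t ^ 2) / t ^ 2)) + ∫ t in X * (5/2)..T, Real.log (t / (2 * π)) / (2 * π) * (Real.exp (-X ^ 2 / t ^ 2) / t ^ 2) :=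
    (intervalIntegral.integral_add_adjacent_intervals (hI _ _ (h4p _ (by norm_num)) (h4p _ (by norm_num)))
      (hI _ _ (h4p _ (by norm_num)) hTop)).symm
  have e9 : (∫ t in X * (5/2)..T, Real.log (t / (2 * π)) / (2 * π) * (Real.exp (-X ^ 2 / t ^ 2) / t ^ 2)) = (∫ t in X * (5/2)..X * (3), Real.log (t / (2 * π)) / (2 * π) * (Real.exp (-X ^ 2 / t ^ 2) / t ^ 2)) + ∫ t in X * (3)..T, Real.log (t / (2 * π)) / (2 * π) * (Real.exp (-X ^ 2 / t ^ 2) / t ^ 2) :=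
    (intervalIntegral.integral_add_adjacent_intervals (hI _ _ (h4p _ (by norm_num)) (h4p _ (by norm_num)))
      (hI _ _ (h4p _ (by norm_num)) hTop)).symm
  have e10 : (∫ t in X * (3)..T, Real.log (t / (2 * π)) / (2 * π) * (Real.exp (-X ^ 2 / t ^ 2) / t ^ 2)) = (∫ t in X * (3)..X * (4), Real.log (t / (2 * π)) / (2 * π) * (Real.exp (-X ^ 2 / t ^ 2) / t ^ 2)) + ∫ t in X * (4)..T, Real.log (t / (2 * π)) / (2 * π) * (Real.exp (-X ^ 2 / t ^ 2) / t ^ 2) :=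
    (intervalIntegral.integral_add_adjacent_intervals (hI _ _ (h4p _ (by norm_num)) (h4p _ (by norm_num)))
      (hI _ _ (h4p _ (by norm_num)) hTop)).symm
  have e11 : (∫ t in X * (4)..T, Real.log (t / (2 * π)) / (2 * π) * (Real.exp (-X ^ 2 / t ^ 2) / t ^ 2)) = (∫ t in X * (4)..X * (6), Real.log (t / (2 * π)) / (2 * π) * (Real.exp (-X ^ 2 / t ^ 2) / t ^ 2)) + ∫ t in X * (6)..T, Real.log (t / (2 * π)) / (2 * π) * (Real.exp (-X ^ 2 / t ^ 2) / t ^ 2) :=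
    (intervalIntegral.integral_add_adjacent_intervals (hI _ _ (h4p _ (by norm_num)) (h4p _ (by norm_num)))
      (hI _ _ (h4p _ (by norm_num)) hTop)).symm
  have e12 : (∫ t in X * (6)..T, Real.log (t / (2 * π)) / (2 * π) * (Real.exp (-X ^ 2 / t ^ 2) / t ^ 2)) = (∫ t in X * (6)..X * (8), Real.log (t / (2 * π)) / (2 * π) * (Real.exp (-X ^ 2 / t ^ 2) / t ^ 2)) + ∫ t in X * (8)..T, Real.log (t / (2 * π)) / (2 * π) * (Real.exp (-X ^ 2 / t ^ 2) / t ^ 2) :=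
    (intervalIntegral.integral_add_adjacent_intervals (hI _ _ (h4p _ (by norm_num)) (h4p _ (by norm_num)))
      (hI _ _ (h4p _ (by norm_num)) hTop)).symm
  -- piece 7: [3/2, 2]
  have hq7 : Real.log (2 : ℝ) ≤ 0.6932 := by linarith only [Real.log_two_lt_d9]
  have hr7 : Real.exp (-1 / (2 : ℝ) ^ 2) ≤ 0.778801 := by
    rw [show (-1 : ℝ) / (2 : ℝ) ^ 2 = -(1/4) by norm_num]
    exact exp_neg_le_of_taylor5 (by norm_num) (by norm_num)
  have h7 : (∫ t in X * (3/2)..X * (2), Real.log (t / (2 * π)) / (2 * π) * (Real.exp (-X ^ 2 / t ^ 2) / t ^ 2)) ≤ (778801 / 6000000 : ℝ) * (Real.log X / (2 * π * X)) + (-2595743733 / 20000000000 : ℝ) * (1 / (2 * π * X)) := by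
    have hp := integral_farDensity_piece_le (p := 3/2) (q := 2) hX0 (by norm_num) (by norm_num) (h2πp _ (by norm_num))
    have hqpos : (0:ℝ) < (2 : ℝ) := by norm_num
    have hXq : 0 < X * (2 : ℝ) := mul_pos hX0 hqpos
    have elog : Real.log (X * (2 : ℝ) / (2 * π)) = Real.log X + Real.log (2 : ℝ) - Real.log (2 * π) := by
      rw [Real.log_div hXq.ne' h2π0.ne', Real.log_mul hX0.ne' hqpos.ne']
    have hnn : 0 ≤ Real.log X + Real.log (2 : ℝ) - Real.log (2 * π) := by
      rw [← elog]
      exact Real.log_nonneg (by rw [le_div_iff₀ h2π0]; linarith only [h2πp (2 : ℝ) (by norm_num)])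
    have hd : (0 : ℝ) ≤ (1 / (3/2) - 1 / (2)) / X := div_nonneg (by norm_num) hX0.le
    have hw : (Real.log X + Real.log (2 : ℝ) - Real.log (2 * π)) / (2 * π) * Real.exp (-1 / (2 : ℝ) ^ 2) * ((1 / (3/2) - 1 / (2)) / X) ≤
        (Real.log X + 0.6932 - 1.6931) / (2 * π) * 0.778801 * ((1 / (3/2) - 1 / (2)) / X) :=
      mul_le_mul (mul_le_mul (div_le_div_of_nonneg_right (by linarith only [hq7, hL2π]) (by positivity)) hr7 (Real.exp_pos _).le
        (div_nonneg (hnn.trans (by linarith only [hq7, hL2π])) (by positivity))) le_rfl hd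
        (mul_nonneg (div_nonneg (hnn.trans (by linarith only [hq7, hL2π])) (by positivity)) (by norm_num))
    have he : (Real.log X + 0.6932 - 1.6931) / (2 * π) * 0.778801 * ((1 / (3/2) - 1 / (2)) / X) = (778801 / 6000000 : ℝ) * (Real.log X / (2 * π * X)) + (-2595743733 / 20000000000 : ℝ) * (1 / (2 * π * X)) := by
      ring
    linarith only [hp, hw, he]
  -- piece 8: [2, 5/2]
  have hq8 : Real.log (5/2 : ℝ) ≤ 0.9432 := by
    rw [show (5/2:ℝ) = 2 * (5/4) by norm_num, Real.log_mul (by norm_num : (2:ℝ) ≠ 0) (by norm_num : (5/4:ℝ) ≠ 0)]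
    linarith only [Real.log_two_lt_d9, Real.log_le_sub_one_of_pos (show (0:ℝ) < 5/4 by norm_num)]
  have hr8 : Real.exp (-1 / (5/2 : ℝ) ^ 2) ≤ 0.852144 := by
    rw [show (-1 : ℝ) / (5/2 : ℝ) ^ 2 = -(4/25) by norm_num]
    exact exp_neg_le_of_taylor5 (by norm_num) (by norm_num)
  have h8 : (∫ t in X * (2)..X * (5/2), Real.log (t / (2 * π)) / (2 * π) * (Real.exp (-X ^ 2 / t ^ 2) / t ^ 2)) ≤ (53259 / 625000 : ℝ) * (Real.log X / (2 * π * X)) + (-399389241 / 6250000000 : ℝ) * (1 / (2 * π * X)) := by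
    have hp := integral_farDensity_piece_le (p := 2) (q := 5/2) hX0 (by norm_num) (by norm_num) (h2πp _ (by norm_num))
    have hqpos : (0:ℝ) < (5/2 : ℝ) := by norm_num
    have hXq : 0 < X * (5/2 : ℝ) := mul_pos hX0 hqpos
    have elog : Real.log (X * (5/2 : ℝ) / (2 * π)) = Real.log X + Real.log (5/2 : ℝ) - Real.log (2 * π) := by
      rw [Real.log_div hXq.ne' h2π0.ne', Real.log_mul hX0.ne' hqpos.ne']
    have hnn : 0 ≤ Real.log X + Real.log (5/2 : ℝ) - Real.log (2 * π) := by
      rw [← elog]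
      exact Real.log_nonneg (by rw [le_div_iff₀ h2π0]; linarith only [h2πp (5/2 : ℝ) (by norm_num)])
    have hd : (0 : ℝ) ≤ (1 / (2) - 1 / (5/2)) / X := div_nonneg (by norm_num) hX0.le
    have hw : (Real.log X + Real.log (5/2 : ℝ) - Real.log (2 * π)) / (2 * π) * Real.exp (-1 / (5/2 : ℝ) ^ 2) * ((1 / (2) - 1 / (5/2)) / X) ≤
        (Real.log X + 0.9432 - 1.6931) / (2 * π) * 0.852144 * ((1 / (2) - 1 / (5/2)) / X) :=
      mul_le_mul (mul_le_mul (div_le_div_of_nonneg_right (by linarith only [hq8, hL2π]) (by positivity)) hr8 (Real.exp_pos _).le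
        (div_nonneg (hnn.trans (by linarith only [hq8, hL2π])) (by positivity))) le_rfl hd
        (mul_nonneg (div_nonneg (hnn.trans (by linarith only [hq8, hL2π])) (by positivity)) (by norm_num))
    have he : (Real.log X + 0.9432 - 1.6931) / (2 * π) * 0.852144 * ((1 / (2) - 1 / (5/2)) / X) = (53259 / 625000 : ℝ) * (Real.log X / (2 * π * X)) + (-399389241 / 6250000000 : ℝ) * (1 / (2 * π * X)) := by
      ring
    linarith only [hp, hw, he]
  -- piece 9: [5/2, 3]
  have hq9 : Real.log (3 : ℝ) ≤ 1.1932 := by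
    rw [show (3:ℝ) = 2 * (3/2) by norm_num, Real.log_mul (by norm_num : (2:ℝ) ≠ 0) (by norm_num : (3/2:ℝ) ≠ 0)]
    linarith only [Real.log_two_lt_d9, Real.log_le_sub_one_of_pos (show (0:ℝ) < 3/2 by norm_num)]
  have hr9 : Real.exp (-1 / (3 : ℝ) ^ 2) ≤ 0.894840 := by
    rw [show (-1 : ℝ) / (3 : ℝ) ^ 2 = -(1/9) by norm_num]
    exact exp_neg_le_of_taylor5 (by norm_num) (by norm_num)
  have h9 : (∫ t in X * (5/2)..X * (3), Real.log (t / (2 * π)) / (2 * π) * (Real.exp (-X ^ 2 / t ^ 2) / t ^ 2)) ≤ (7457 / 125000 : ℝ) * (Real.log X / (2 * π * X)) + (-37277543 / 1250000000 : ℝ) * (1 / (2 * π * X)) := by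
    have hp := integral_farDensity_piece_le (p := 5/2) (q := 3) hX0 (by norm_num) (by norm_num) (h2πp _ (by norm_num))
    have hqpos : (0:ℝ) < (3 : ℝ) := by norm_num
    have hXq : 0 < X * (3 : ℝ) := mul_pos hX0 hqpos
    have elog : Real.log (X * (3 : ℝ) / (2 * π)) = Real.log X + Real.log (3 : ℝ) - Real.log (2 * π) := by
      rw [Real.log_div hXq.ne' h2π0.ne', Real.log_mul hX0.ne' hqpos.ne']
    have hnn : 0 ≤ Real.log X + Real.log (3 : ℝ) - Real.log (2 * π) := by
      rw [← elog]
      exact Real.log_nonneg (by rw [le_div_iff₀ h2π0]; linarith only [h2πp (3 : ℝ) (by norm_num)])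
    have hd : (0 : ℝ) ≤ (1 / (5/2) - 1 / (3)) / X := div_nonneg (by norm_num) hX0.le
    have hw : (Real.log X + Real.log (3 : ℝ) - Real.log (2 * π)) / (2 * π) * Real.exp (-1 / (3 : ℝ) ^ 2) * ((1 / (5/2) - 1 / (3)) / X) ≤
        (Real.log X + 1.1932 - 1.6931) / (2 * π) * 0.894840 * ((1 / (5/2) - 1 / (3)) / X) :=
      mul_le_mul (mul_le_mul (div_le_div_of_nonneg_right (by linarith only [hq9, hL2π]) (by positivity)) hr9 (Real.exp_pos _).le
        (div_nonneg (hnn.trans (by linarith only [hq9, hL2π])) (by positivity))) le_rfl hd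
        (mul_nonneg (div_nonneg (hnn.trans (by linarith only [hq9, hL2π])) (by positivity)) (by norm_num))
    have he : (Real.log X + 1.1932 - 1.6931) / (2 * π) * 0.894840 * ((1 / (5/2) - 1 / (3)) / X) = (7457 / 125000 : ℝ) * (Real.log X / (2 * π * X)) + (-37277543 / 1250000000 : ℝ) * (1 / (2 * π * X)) := by
      ring
    linarith only [hp, hw, he]
  -- piece 10: [3, 4]
  have hq10 : Real.log (4 : ℝ) ≤ 1.3864 := by
    rw [show (4:ℝ) = 2 ^ 2 by norm_num, Real.log_pow]; push_cast; linarith only [Real.log_two_lt_d9]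
  have hr10 : Real.exp (-1 / (4 : ℝ) ^ 2) ≤ 0.939414 := by
    rw [show (-1 : ℝ) / (4 : ℝ) ^ 2 = -(1/16) by norm_num]
    exact exp_neg_le_of_taylor5 (by norm_num) (by norm_num)
  have h10 : (∫ t in X * (3)..X * (4), Real.log (t / (2 * π)) / (2 * π) * (Real.exp (-X ^ 2 / t ^ 2) / t ^ 2)) ≤ (156569 / 2000000 : ℝ) * (Real.log X / (2 * π * X)) + (-480197123 / 20000000000 : ℝ) * (1 / (2 * π * X)) := by
    have hp := integral_farDensity_piece_le (p := 3) (q := 4) hX0 (by norm_num) (by norm_num) (h2πp _ (by norm_num))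
    have hqpos : (0:ℝ) < (4 : ℝ) := by norm_num
    have hXq : 0 < X * (4 : ℝ) := mul_pos hX0 hqpos
    have elog : Real.log (X * (4 : ℝ) / (2 * π)) = Real.log X + Real.log (4 : ℝ) - Real.log (2 * π) := by
      rw [Real.log_div hXq.ne' h2π0.ne', Real.log_mul hX0.ne' hqpos.ne']
    have hnn : 0 ≤ Real.log X + Real.log (4 : ℝ) - Real.log (2 * π) := by
      rw [← elog]
      exact Real.log_nonneg (by rw [le_div_iff₀ h2π0]; linarith only [h2πp (4 : ℝ) (by norm_num)])
    have hd : (0 : ℝ) ≤ (1 / (3) - 1 / (4)) / X := div_nonneg (by norm_num) hX0.le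
    have hw : (Real.log X + Real.log (4 : ℝ) - Real.log (2 * π)) / (2 * π) * Real.exp (-1 / (4 : ℝ) ^ 2) * ((1 / (3) - 1 / (4)) / X) ≤
        (Real.log X + 1.3864 - 1.6931) / (2 * π) * 0.939414 * ((1 / (3) - 1 / (4)) / X) :=
      mul_le_mul (mul_le_mul (div_le_div_of_nonneg_right (by linarith only [hq10, hL2π]) (by positivity)) hr10 (Real.exp_pos _).le
        (div_nonneg (hnn.trans (by linarith only [hq10, hL2π])) (by positivity))) le_rfl hd
        (mul_nonneg (div_nonneg (hnn.trans (by linarith only [hq10, hL2π])) (by positivity)) (by norm_num))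
    have he : (Real.log X + 1.3864 - 1.6931) / (2 * π) * 0.939414 * ((1 / (3) - 1 / (4)) / X) = (156569 / 2000000 : ℝ) * (Real.log X / (2 * π * X)) + (-480197123 / 20000000000 : ℝ) * (1 / (2 * π * X)) := by
      ring
    linarith only [hp, hw, he]
  -- piece 11: [4, 6]
  have hq11 : Real.log (6 : ℝ) ≤ 1.8864 := by
    rw [show (6:ℝ) = 2 ^ 2 * (3/2) by norm_num, Real.log_mul (by norm_num : (2:ℝ)^2 ≠ 0) (by norm_num : (3/2:ℝ) ≠ 0), Real.log_pow]
    push_cast; linarith only [Real.log_two_lt_d9, Real.log_le_sub_one_of_pos (show (0:ℝ) < 3/2 by norm_num)]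
  have hr11 : Real.exp (-1 / (6 : ℝ) ^ 2) ≤ 0.972605 := by
    rw [show (-1 : ℝ) / (6 : ℝ) ^ 2 = -(1/36) by norm_num]
    exact exp_neg_le_of_taylor5 (by norm_num) (by norm_num)
  have h11 : (∫ t in X * (4)..X * (6), Real.log (t / (2 * π)) / (2 * π) * (Real.exp (-X ^ 2 / t ^ 2) / t ^ 2)) ≤ (194521 / 2400000 : ℝ) * (Real.log X / (2 * π * X)) + (376009093 / 24000000000 : ℝ) * (1 / (2 * π * X)) := by
    have hp := integral_farDensity_piece_le (p := 4) (q := 6) hX0 (by norm_num) (by norm_num) (h2πp _ (by norm_num))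
    have hqpos : (0:ℝ) < (6 : ℝ) := by norm_num
    have hXq : 0 < X * (6 : ℝ) := mul_pos hX0 hqpos
    have elog : Real.log (X * (6 : ℝ) / (2 * π)) = Real.log X + Real.log (6 : ℝ) - Real.log (2 * π) := by
      rw [Real.log_div hXq.ne' h2π0.ne', Real.log_mul hX0.ne' hqpos.ne']
    have hnn : 0 ≤ Real.log X + Real.log (6 : ℝ) - Real.log (2 * π) := by
      rw [← elog]
      exact Real.log_nonneg (by rw [le_div_iff₀ h2π0]; linarith only [h2πp (6 : ℝ) (by norm_num)])
    have hd : (0 : ℝ) ≤ (1 / (4) - 1 / (6)) / X := div_nonneg (by norm_num) hX0.le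
    have hw : (Real.log X + Real.log (6 : ℝ) - Real.log (2 * π)) / (2 * π) * Real.exp (-1 / (6 : ℝ) ^ 2) * ((1 / (4) - 1 / (6)) / X) ≤
        (Real.log X + 1.8864 - 1.6931) / (2 * π) * 0.972605 * ((1 / (4) - 1 / (6)) / X) :=
      mul_le_mul (mul_le_mul (div_le_div_of_nonneg_right (by linarith only [hq11, hL2π]) (by positivity)) hr11 (Real.exp_pos _).le
        (div_nonneg (hnn.trans (by linarith only [hq11, hL2π])) (by positivity))) le_rfl hd
        (mul_nonneg (div_nonneg (hnn.trans (by linarith only [hq11, hL2π])) (by positivity)) (by norm_num))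
    have he : (Real.log X + 1.8864 - 1.6931) / (2 * π) * 0.972605 * ((1 / (4) - 1 / (6)) / X) = (194521 / 2400000 : ℝ) * (Real.log X / (2 * π * X)) + (376009093 / 24000000000 : ℝ) * (1 / (2 * π * X)) := by
      ring
    linarith only [hp, hw, he]
  -- piece 12: [6, 8]
  have hq12 : Real.log (8 : ℝ) ≤ 2.0796 := by
    rw [show (8:ℝ) = 2 ^ 3 by norm_num, Real.log_pow]; push_cast; linarith only [Real.log_two_lt_d9]
  have hr12 : Real.exp (-1 / (8 : ℝ) ^ 2) ≤ 0.984497 := by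
    rw [show (-1 : ℝ) / (8 : ℝ) ^ 2 = -(1/64) by norm_num]
    exact exp_neg_le_of_taylor5 (by norm_num) (by norm_num)
  have h12 : (∫ t in X * (6)..X * (8), Real.log (t / (2 * π)) / (2 * π) * (Real.exp (-X ^ 2 / t ^ 2) / t ^ 2)) ≤ (984497 / 24000000 : ℝ) * (Real.log X / (2 * π * X)) + (761016181 / 48000000000 : ℝ) * (1 / (2 * π * X)) := by
    have hp := integral_farDensity_piece_le (p := 6) (q := 8) hX0 (by norm_num) (by norm_num) (h2πp _ (by norm_num))
    have hqpos : (0:ℝ) < (8 : ℝ) := by norm_num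
    have hXq : 0 < X * (8 : ℝ) := mul_pos hX0 hqpos
    have elog : Real.log (X * (8 : ℝ) / (2 * π)) = Real.log X + Real.log (8 : ℝ) - Real.log (2 * π) := by
      rw [Real.log_div hXq.ne' h2π0.ne', Real.log_mul hX0.ne' hqpos.ne']
    have hnn : 0 ≤ Real.log X + Real.log (8 : ℝ) - Real.log (2 * π) := by
      rw [← elog]
      exact Real.log_nonneg (by rw [le_div_iff₀ h2π0]; linarith only [h2πp (8 : ℝ) (by norm_num)])
    have hd : (0 : ℝ) ≤ (1 / (6) - 1 / (8)) / X := div_nonneg (by norm_num) hX0.le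
    have hw : (Real.log X + Real.log (8 : ℝ) - Real.log (2 * π)) / (2 * π) * Real.exp (-1 / (8 : ℝ) ^ 2) * ((1 / (6) - 1 / (8)) / X) ≤
        (Real.log X + 2.0796 - 1.6931) / (2 * π) * 0.984497 * ((1 / (6) - 1 / (8)) / X) :=
      mul_le_mul (mul_le_mul (div_le_div_of_nonneg_right (by linarith only [hq12, hL2π]) (by positivity)) hr12 (Real.exp_pos _).le
        (div_nonneg (hnn.trans (by linarith only [hq12, hL2π])) (by positivity))) le_rfl hd
        (mul_nonneg (div_nonneg (hnn.trans (by linarith only [hq12, hL2π])) (by positivity)) (by norm_num))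
    have he : (Real.log X + 2.0796 - 1.6931) / (2 * π) * 0.984497 * ((1 / (6) - 1 / (8)) / X) = (984497 / 24000000 : ℝ) * (Real.log X / (2 * π * X)) + (761016181 / 48000000000 : ℝ) * (1 / (2 * π * X)) := by
      ring
    linarith only [hp, hw, he]
  -- tail beyond `8X`
  have hq8' : Real.log (8 : ℝ) ≤ 2.0796 := by
    rw [show (8:ℝ) = 2 ^ 3 by norm_num, Real.log_pow]; push_cast; linarith only [Real.log_two_lt_d9]
  have htail : (∫ t in X * (8)..T, Real.log (t / (2 * π)) / (2 * π) * (Real.exp (-X ^ 2 / t ^ 2) / t ^ 2)) ≤ (1 / 8 : ℝ) * (Real.log X / (2 * π * X)) + (2773 / 16000 : ℝ) * (1 / (2 * π * X)) := by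
    have ht := integral_farDensity_tail_le (X := X) (lo := X * 8) (T := T) (h2πp _ (by norm_num)) hT
    have h1 : (Real.log (X * 8 / (2 * π)) + 1) / (2 * π * (X * 8)) ≤ (Real.log X + 2.0796 - 1.6931 + 1) / (2 * π * (X * 8)) := by
      refine div_le_div_of_nonneg_right ?_ (by positivity)
      have hX8 : 0 < X * 8 := by positivity
      rw [Real.log_div hX8.ne' h2π0.ne', Real.log_mul hX0.ne' (by norm_num : (8:ℝ) ≠ 0)]
      linarith only [hq8', hL2π]
    have he : (Real.log X + 2.0796 - 1.6931 + 1) / (2 * π * (X * 8)) = (1 / 8 : ℝ) * (Real.log X / (2 * π * X)) + (2773 / 16000 : ℝ) * (1 / (2 * π * X)) := by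
      ring
    linarith only [ht, h1, he]
  -- add up
  linarith only [e7, e8, e9, e10, e11, e12, h7, h8, h9, h10, h11, h12, htail]

/-- The final numeric step of `integral_farDensity_le`, over abstract reals (`p` plays `π`). [this track, ATTEMPT-24 §1] -/
theorem farDensity_numeric_final (ℓ Y p : ℝ) (hp1 : 3.141592 < p) (hp2 : p < 3.141593) (hY : 0 < Y) (hℓ : 0 ≤ ℓ) :
    (6204527 / 15000000 : ℝ) * (ℓ / (2 * p * Y)) + (-8449956231 / 12500000000 : ℝ) * (1 / (2 * p * Y)) + ((72003143 / 120000000 : ℝ) * (ℓ / (2 * p * Y)) + (-17074922579 / 400000000000 : ℝ) * (1 / (2 * p * Y))) ≤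
      (0.16135 * ℓ - 0.1143) / Y := by
  have hp : 0 < p := by linarith
  have e : (6204527 / 15000000 : ℝ) * (ℓ / (2 * p * Y)) + (-8449956231 / 12500000000 : ℝ) * (1 / (2 * p * Y)) + ((72003143 / 120000000 : ℝ) * (ℓ / (2 * p * Y)) + (-17074922579 / 400000000000 : ℝ) * (1 / (2 * p * Y))) =
      (((6204527 / 15000000 : ℝ) + (72003143 / 120000000 : ℝ)) * ℓ + ((-8449956231 / 12500000000 : ℝ) + (-17074922579 / 400000000000 : ℝ))) / (2 * p * Y) := by
    field_simp
    ring
  rw [e, div_le_div_iff₀ (by positivity) hY]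
  have h1 : 0 ≤ ℓ * Y := by positivity
  nlinarith [mul_le_mul_of_nonneg_right hp1.le h1, mul_le_mul_of_nonneg_left hp2.le hY.le, hY, h1]

/-- **The density integral on the fourteen-point grid.** For `X ≥ e⁸` and `T ≥ 8X`:
`∫_{X/4}^{T} (log(t/2π)/(2π)) e^{−X²/t²}/t² dt ≤ (0.16135·log X − 0.1143)/X`
(pieces `X·{1/4,1/3,1/2,2/3,5/6,1,6/5,3/2,2,5/2,3,4,6,8}` by `integral_farDensity_piece_le` with degree-5 Taylor bounds for `e^{−1/q²}`
and `log 2`-based bounds for `log q`; the tail by `integral_farDensity_tail_le`). The sharp value of the leading constant is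
`(1/2π)∫₀^4 e^{−u²}du ≈ 0.1412`. [this track, ATTEMPT-24 §1] -/
theorem integral_farDensity_le {X T : ℝ} (hX : Real.exp 8 ≤ X) (hT : X * 8 ≤ T) :
    ∫ t in X * (1 / 4)..T, Real.log (t / (2 * π)) / (2 * π) * (Real.exp (-X ^ 2 / t ^ 2) / t ^ 2) ≤
      (0.16135 * Real.log X - 0.1143) / X := by
  have hπ := Real.pi_pos
  have hπlo := Real.pi_gt_d6
  have hπhi := Real.pi_lt_d6
  have he8 : (2980 : ℝ) ≤ Real.exp 8 := by
    have h : Real.exp 8 = Real.exp 1 ^ 8 := by rw [← Real.exp_nat_mul]; norm_num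
    rw [h]
    have := Real.exp_one_gt_d9
    nlinarith [pow_le_pow_left₀ (by norm_num : (0:ℝ) ≤ 2.7182818283) this.le 8]
  have hX0 : 0 < X := by linarith
  have hℓ : 8 ≤ Real.log X := by rw [Real.le_log_iff_exp_le hX0]; exact hX
  have hI : ∀ a b : ℝ, X * (1 / 4) ≤ a → X * (1 / 4) ≤ b →
      IntervalIntegrable (fun t : ℝ => Real.log (t / (2 * π)) / (2 * π) * (Real.exp (-X ^ 2 / t ^ 2) / t ^ 2)) volume a b := by
    intro a b ha hb
    refine ContinuousOn.intervalIntegrable (continuousOn_of_forall_continuousAt fun t ht => ?_)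
    have hmin : X * (1 / 4) ≤ min a b := le_min ha hb
    have h1 : min a b ≤ t := ht.1
    have ht0 : 0 < t := by nlinarith
    have : t ≠ 0 := ht0.ne'
    have : t / (2 * π) ≠ 0 := by positivity
    fun_prop (disch := (first | assumption | positivity))
  have hsplit : (∫ t in X * (1 / 4)..T, Real.log (t / (2 * π)) / (2 * π) * (Real.exp (-X ^ 2 / t ^ 2) / t ^ 2)) = (∫ t in X * (1 / 4)..X * (3 / 2), Real.log (t / (2 * π)) / (2 * π) * (Real.exp (-X ^ 2 / t ^ 2) / t ^ 2)) + ∫ t in X * (3 / 2)..T, Real.log (t / (2 * π)) / (2 * π) * (Real.exp (-X ^ 2 / t ^ 2) / t ^ 2) :=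
    (intervalIntegral.integral_add_adjacent_intervals (hI _ _ le_rfl (by nlinarith)) (hI _ _ (by nlinarith) (by nlinarith))).symm
  have hA := integral_farDensity_lower_le hX
  have hB := integral_farDensity_upper_le hX hT
  rw [hsplit]
  refine (add_le_add hA hB).trans ?_
  have hfin := farDensity_numeric_final (Real.log X) X π hπlo hπhi hX0 (by linarith only [hℓ])
  linarith only [hfin]

end Summit.RiemannHypothesis.RiemannHypothesis.Theorems.Handoff

end
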